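import Summits.QuantumFields.BalabanUV.T4Continuum.Support.FirstOrderBackgroundModel

/-!
# T⁴ programme, spine node NE2 (U1a) — PERTURBATION ALGEBRA: the typed inequalities `PerturbationLaws` are closed under sums and
# scalings; ZEROTH-ORDER (potential-type) families satisfy them; hence MINIMAL COUPLING THROUGH SECOND ORDER
# `Δ_a + t·(Σ_μ 𝒜_μ∇_μ + W)` has the η-rate `L^{−k}` for every Lipschitz `𝒜` and every two-level-consistent bounded `W`

Ninth generation of the NE2 prover lineage P1 of the cell `pub-balaban`, file 8 (on top of file 7 `Support/FirstOrderBackgroundModel`).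
A covariant Laplacian in a background `U = e^{iη𝒜}` is, to all orders that matter at fixed `η`, `Δ + (first order: 𝒜·∇-type) +
(zeroth order: bounded multiplication by O(𝒜², ∇𝒜))`.  File 7 treated the first-order part.  Here:

 * §1 ALGEBRA of the hypothesis bundle of `Spine/BackgroundResolventTower`: **`perturbationLaws_add`** (`κ₁ + κ₂`, `e₁ + e₂`),
   **`perturbationLaws_smul`** (`‖c‖κ`, `‖c‖e`), `perturbationLaws_zero`, `perturbationLaws_mono` — (H-bd) and (H-cons) are linear
   constraints on the perturbation family.
 * §2 ZEROTH ORDER: `P_k = diag(W^{(k)})` with `|W^{(k)}| ≤ α` and the two-spacing consistency `|W^{(k+1)}(x′) − W^{(k)}(par x′)| ≤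
   β·L^{−k}` (`BoundedBackground`) satisfies `PerturbationLaws` with `κ = α·Cst`, `e₂ k = Cst²β·L^{−k}` (**`perturbationLaws_zerothOrder`**;
   two-level identity `diag W′·J − J·diag W = (diag W′ − diag(W ∘ parT))·J`, file 6).
 * §3 **`towerLimitRate_minimalCoupling`**: for every Lipschitz first-order background `𝒜` (file 7's `LipschitzBackground α β`) and
   every bounded consistent zeroth-order background `W` (`BoundedBackground α′ β′`), and every coupling
   `‖t‖·(d(α + β) + α′)·Cst < 1`, the King-averaged unit-lattice covariance of `(Δ_a^{(k)} + t(Σ_μ diag(𝒜^{(k)}_μ)∇^{(k)}_μ +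
   diag(W^{(k)})))⁻¹` CONVERGES with rate `L^{−k}` and an explicit constant.  NO typed residual.

HONEST FRAMING (T4-DAG p. 1).  Still a MODEL (abelian-type minimal coupling through second order, global small gauge, King's outer
averaging; not Bałaban's `Δ_a(U)` with its `∂_UP_U∂_U*` and `aQ(U)*Q(U)` terms); finite torus, linear layer, operator norm; rates
/ pairing / constants OURS; NOT infinite volume / mass gap / Clay / summit progress; spine 0/9 unchanged.  HONEST DEPENDENCY:
continuum YM on T⁴ ⇐ BetaPertH ∧ nine spine estimates (0/9 proved); BetaPertH ⇐ (D1) ∧ (D4) ∧ CAP+tail; G-an2-4 gates asym, D1 and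
NE2/3/4.  ABSOLUTE RULE kept; no `sorry`.
-/

noncomputable section

open scoped BigOperators ComplexConjugate Matrix Matrix.Norms.L2Operator
open Filter Topology

namespace Summit.QuantumFields.BalabanUV.T4Continuum.PerturbationAlgebra

open Literature.MathematicalPhysics.QuantumFieldTheory.Balaban1983to89.B5Prop11Plancherel
open Literature.MathematicalPhysics.QuantumFieldTheory.Balaban1983to89.B5G183RateUnitTower (lev lev_neZero)
open Summit.QuantumFields.BalabanUV.T4Continuum
open Summit.QuantumFields.BalabanUV.T4Continuum.CovariantAveragingTower (TowerLimitRate)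
open Summit.QuantumFields.BalabanUV.T4Continuum.BalabanAveragedTowerUnit (idx Qlev calGlev one_le_lev' cast_lev')
open Summit.QuantumFields.BalabanUV.T4Continuum.BackgroundResolventTower
open Summit.QuantumFields.BalabanUV.T4Continuum.KingPairingPlantedLaw
open Summit.QuantumFields.BalabanUV.T4Continuum.BlockPairingGeometry
open Summit.QuantumFields.BalabanUV.T4Continuum.NE2PerturbedLayer
open Summit.QuantumFields.BalabanUV.T4Continuum.FirstOrderBackgroundModel

variable {d : ℕ}

/-! ## §1 `PerturbationLaws` is a cone -/

section Algebra

variable {ι : ℕ → Type*} [∀ k, Fintype (ι k)] [∀ k, DecidableEq (ι k)]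
variable {D : (k : ℕ) → Matrix (ι k) (ι k) ℂ} {J : (k : ℕ) → Matrix (ι (k + 1)) (ι k) ℂ}

/-- **SUMS**: (H-bd)/(H-cons) for `P₁` (`κ₁, e₁`) and `P₂` (`κ₂, e₂`) give them for `P₁ + P₂` (`κ₁ + κ₂, e₁ + e₂`). [folklore] -/
theorem perturbationLaws_add {P₁ P₂ : (k : ℕ) → Matrix (ι k) (ι k) ℂ} {κ₁ κ₂ : ℝ} {e₁ e₂ : ℕ → ℝ}
    (h₁ : PerturbationLaws D P₁ J κ₁ e₁) (h₂ : PerturbationLaws D P₂ J κ₂ e₂) :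
    PerturbationLaws D (fun k => P₁ k + P₂ k) J (κ₁ + κ₂) (fun k => e₁ k + e₂ k) where
  opNorm_P_mul_inv_le := fun k => by
    rw [Matrix.add_mul]
    exact (norm_add_le _ _).trans (add_le_add (h₁.opNorm_P_mul_inv_le k) (h₂.opNorm_P_mul_inv_le k))
  opNorm_inv_mul_P_le := fun k => by
    rw [Matrix.mul_add]
    exact (norm_add_le _ _).trans (add_le_add (h₁.opNorm_inv_mul_P_le k) (h₂.opNorm_inv_mul_P_le k))
  consistent_le := fun k => by
    have e0 : (P₁ (k + 1) + P₂ (k + 1)) * J k - J k * (P₁ k + P₂ k)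
        = (P₁ (k + 1) * J k - J k * P₁ k) + (P₂ (k + 1) * J k - J k * P₂ k) := by
      rw [Matrix.add_mul, Matrix.mul_add]; abel
    rw [e0, Matrix.mul_add, Matrix.add_mul]
    exact (norm_add_le _ _).trans (add_le_add (h₁.consistent_le k) (h₂.consistent_le k))

/-- **SCALINGS**: `PerturbationLaws` for `c·P` with `‖c‖κ`, `‖c‖e`. [folklore] -/
theorem perturbationLaws_smul {P : (k : ℕ) → Matrix (ι k) (ι k) ℂ} {κ : ℝ} {e : ℕ → ℝ} (c : ℂ)
    (h : PerturbationLaws D P J κ e) : PerturbationLaws D (fun k => c • P k) J (‖c‖ * κ) (fun k => ‖c‖ * e k) where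
  opNorm_P_mul_inv_le := fun k => by
    rw [Matrix.smul_mul, norm_smul]; exact mul_le_mul_of_nonneg_left (h.opNorm_P_mul_inv_le k) (norm_nonneg c)
  opNorm_inv_mul_P_le := fun k => by
    rw [Matrix.mul_smul, norm_smul]; exact mul_le_mul_of_nonneg_left (h.opNorm_inv_mul_P_le k) (norm_nonneg c)
  consistent_le := fun k => by
    rw [Matrix.smul_mul, Matrix.mul_smul, ← smul_sub, Matrix.mul_smul, Matrix.smul_mul, norm_smul]
    exact mul_le_mul_of_nonneg_left (h.consistent_le k) (norm_nonneg c)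

/-- the trivial family. [folklore] -/
theorem perturbationLaws_zero : PerturbationLaws D (fun k => (0 : Matrix (ι k) (ι k) ℂ)) J 0 (fun _ => 0) where
  opNorm_P_mul_inv_le := fun k => by rw [Matrix.zero_mul, norm_zero]
  opNorm_inv_mul_P_le := fun k => by rw [Matrix.mul_zero, norm_zero]
  consistent_le := fun k => by rw [Matrix.zero_mul, Matrix.mul_zero, sub_self, Matrix.mul_zero, Matrix.zero_mul, norm_zero]

/-- monotonicity in the constants. [folklore] -/
theorem perturbationLaws_mono {P : (k : ℕ) → Matrix (ι k) (ι k) ℂ} {κ κ' : ℝ} {e e' : ℕ → ℝ} (h : PerturbationLaws D P J κ e)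
    (hκ : κ ≤ κ') (he : ∀ k, e k ≤ e' k) : PerturbationLaws D P J κ' e' where
  opNorm_P_mul_inv_le := fun k => (h.opNorm_P_mul_inv_le k).trans hκ
  opNorm_inv_mul_P_le := fun k => (h.opNorm_inv_mul_P_le k).trans hκ
  consistent_le := fun k => (h.consistent_le k).trans (he k)

end Algebra

/-! ## §2 Zeroth order: two-level consistent bounded potentials -/

section Zeroth

variable (L : ℕ) [NeZero L] (M : Fin d → ℕ) [hM : ∀ μ, NeZero (M μ)] (a : ℝ) (ha : 0 < a)

/-- **A BOUNDED BACKGROUND POTENTIAL SAMPLED AT EVERY SPACING**: `W k` on the lattice `L^{−k}` with size `≤ α` and two-spacing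
consistency `|W^{(k+1)}(x′) − W^{(k)}(par x′)| ≤ β/L^k` (no Lipschitz condition needed at zeroth order).  A hypothesis on DATA.
[folklore] -/
structure BoundedBackground (W : (k : ℕ) → (idx L M k → ℂ)) (α β : ℝ) : Prop where
  /-- `α, β ≥ 0` -/
  nonneg : 0 ≤ α ∧ 0 ≤ β
  /-- size -/
  bound : ∀ k i, ‖W k i‖ ≤ α
  /-- two-spacing consistency at the block parent -/
  consistent : ∀ k (i : idx L M (k + 1)), ‖W (k + 1) i - W k (parT (lev L k) L M i)‖ ≤ β / (lev L k : ℕ)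

/-- **`PerturbationLaws` AT ZEROTH ORDER**: `P_k = diag(W^{(k)})` with `κ = α·Cst`, `e₂ k = Cst²β·L^{−k}` (two-level identity
`diag W′·J − J·diag W = (diag W′ − diag(W ∘ parT))·J`). [cite: Balaban1984PropagatorsI, Prop. 1.1 (1.89) p.33] [folklore] -/
theorem perturbationLaws_zerothOrder {W : (k : ℕ) → (idx L M k → ℂ)} {α β : ℝ} (hW : BoundedBackground L M W α β) :
    PerturbationLaws (calDalev L M a ha) (fun k => Matrix.diagonal (W k)) (JpcT L M) (α * Cst d a)
      (fun k => Cst d a * β * Cst d a * ((L : ℝ)⁻¹) ^ k) where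
  opNorm_P_mul_inv_le := fun k =>
    (Matrix.l2_opNorm_mul _ _).trans (mul_le_mul (opNorm_diagonal_le _ hW.nonneg.1 (hW.bound k))
      (opNorm_inv_calDalev_le L M a ha k) (norm_nonneg _) hW.nonneg.1)
  opNorm_inv_mul_P_le := fun k => by
    rw [mul_comm α]
    exact (Matrix.l2_opNorm_mul _ _).trans (mul_le_mul (opNorm_inv_calDalev_le L M a ha k)
      (opNorm_diagonal_le _ hW.nonneg.1 (hW.bound k)) (norm_nonneg _) (Cst_nonneg d a))
  consistent_le := fun k => by
    have hlev : (0 : ℝ) < (lev L k : ℕ) := by exact_mod_cast one_le_lev' L k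
    have hC := Cst_nonneg d a
    -- `diag W′ J − J diag W = (diag W′ − diag (W ∘ parT)) J`
    have h' : JpcT L M k * Matrix.diagonal (W k)
        = Matrix.diagonal (fun i : idx L M (k + 1) => W k (parT (lev L k) L M i)) * JpcT L M k :=
      JK_mul_diagonal (lev L k) L M (W k)
    have e : Matrix.diagonal (W (k + 1)) * JpcT L M k - JpcT L M k * Matrix.diagonal (W k)
        = (Matrix.diagonal (W (k + 1)) - Matrix.diagonal (fun i : idx L M (k + 1) => W k (parT (lev L k) L M i))) * JpcT L M k := by
      rw [Matrix.sub_mul, h']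
    have hdiff : ‖Matrix.diagonal (W (k + 1)) - Matrix.diagonal (fun i : idx L M (k + 1) => W k (parT (lev L k) L M i))‖
        ≤ β / (lev L k : ℕ) := by
      rw [Matrix.diagonal_sub]
      exact opNorm_diagonal_le _ (div_nonneg hW.nonneg.2 hlev.le) fun i => hW.consistent k i
    rw [e, ← Matrix.mul_assoc]
    calc _ ≤ ‖(calDalev L M a ha (k + 1))⁻¹ * (Matrix.diagonal (W (k + 1))
              - Matrix.diagonal (fun i : idx L M (k + 1) => W k (parT (lev L k) L M i))) * JpcT L M k‖
              * ‖(calDalev L M a ha k)⁻¹‖ := Matrix.l2_opNorm_mul _ _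
      _ ≤ ‖(calDalev L M a ha (k + 1))⁻¹ * (Matrix.diagonal (W (k + 1))
              - Matrix.diagonal (fun i : idx L M (k + 1) => W k (parT (lev L k) L M i)))‖
              * ‖JpcT L M k‖ * ‖(calDalev L M a ha k)⁻¹‖ :=
          mul_le_mul_of_nonneg_right (Matrix.l2_opNorm_mul _ _) (norm_nonneg _)
      _ ≤ (Cst d a * (β / (lev L k : ℕ))) * 1 * Cst d a := by
          have h0 : 0 ≤ Cst d a * (β / (lev L k : ℕ)) := mul_nonneg hC (div_nonneg hW.nonneg.2 hlev.le)
          refine mul_le_mul (mul_le_mul ((Matrix.l2_opNorm_mul _ _).trans (mul_le_mul (opNorm_inv_calDalev_le L M a ha (k + 1))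
            hdiff (norm_nonneg _) hC)) (opNorm_JpcT_le L M k) (norm_nonneg _) h0) (opNorm_inv_calDalev_le L M a ha k)
            (norm_nonneg _) (mul_nonneg h0 zero_le_one)
      _ = Cst d a * β * Cst d a * ((L : ℝ)⁻¹) ^ k := by rw [cast_lev', inv_pow]; ring

end Zeroth

/-! ## §3 Minimal coupling through second order -/

section Combined

variable (L : ℕ) [NeZero L] (M : Fin d → ℕ) [hM : ∀ μ, NeZero (M μ)] (a : ℝ) (ha : 0 < a)

/-- the combined perturbation `P_k = Σ_μ diag(𝒜^{(k)}_μ)∇^{(k)}_μ + diag(W^{(k)})`. [folklore] -/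
def Pmc (V : (k : ℕ) → Fin d → (idx L M k → ℂ)) (W : (k : ℕ) → (idx L M k → ℂ)) (k : ℕ) : Matrix (idx L M k) (idx L M k) ℂ :=
  Pmodel L M V k + Matrix.diagonal (W k)

/-- the relative bound of the combined family: `κ = (d(α + β) + α′)·Cst`. [folklore] -/
def kappaMC (d : ℕ) (a α β α' : ℝ) : ℝ := d * (α + β) * Cst d a + α' * Cst d a

/-- the consistency constant of the combined family: `C₂ + Cst²β′`. [folklore] -/
def C2MC (d L : ℕ) (a α β β' : ℝ) : ℝ := C2model d L a α β + Cst d a * β' * Cst d a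

/-- **`PerturbationLaws` FOR MINIMAL COUPLING THROUGH SECOND ORDER** (`d ≥ 1`). [folklore] -/
theorem perturbationLaws_minimalCoupling (hd : 1 ≤ d) {V : (k : ℕ) → Fin d → (idx L M k → ℂ)} {W : (k : ℕ) → (idx L M k → ℂ)}
    {α β α' β' : ℝ} (hV : LipschitzBackground L M V α β) (hW : BoundedBackground L M W α' β') :
    PerturbationLaws (calDalev L M a ha) (Pmc L M V W) (JpcT L M) (kappaMC d a α β α')
      (fun k => C2MC d L a α β β' * ((L : ℝ)⁻¹) ^ k) := by
  have h := perturbationLaws_add (perturbationLaws_firstOrder L M a ha hd hV) (perturbationLaws_zerothOrder L M a ha hW)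
  refine perturbationLaws_mono h le_rfl fun k => le_of_eq ?_
  simp only [C2MC]; ring

/-- **THE η-RATE FOR MINIMAL COUPLING THROUGH SECOND ORDER** (`L ≥ 2`, `d ≥ 1`): for every Lipschitz first-order background
`𝒜` (`α, β`), every bounded two-level-consistent potential `W` (`α′, β′`) and every coupling `‖t‖·κ < 1`, `κ = (d(α + β) + α′)Cst`,
the King-averaged unit-lattice covariance of `(Δ_a^{(k)} + t·(Σ_μ diag(𝒜^{(k)}_μ)∇^{(k)}_μ + diag(W^{(k)})))⁻¹` CONVERGES with
`‖c_k(t) − c_∞(t)‖ ≤ Cpert(t)·L^{−k}/(1 − L^{−1})`, `Cpert(t) = (CJ + ‖t‖(C₂ + Cst²β′))(1 − ‖t‖κ)^{−2} + 2dCst(1 − ‖t‖κ)^{−1}`.  NO typed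
residual; statement, pairing and constants OURS. [cite: King1986, Lemma 4.5 (4.32)/(4.38) p.674; Balaban1984PropagatorsI, (1.69)
p.29, Prop. 1.1 (1.89) p.33; Balaban1985BackgroundPropagators, (3.3) p.390 (shape of the covariant coupling)] [folklore] -/
theorem towerLimitRate_minimalCoupling (hL : 2 ≤ L) (hd : 1 ≤ d) {V : (k : ℕ) → Fin d → (idx L M k → ℂ)}
    {W : (k : ℕ) → (idx L M k → ℂ)} {α β α' β' : ℝ} (hV : LipschitzBackground L M V α β) (hW : BoundedBackground L M W α' β')
    {t : ℂ} (ht : ‖t‖ * kappaMC d a α β α' < 1) :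
    TowerLimitRate (Qlev L M) ((L : ℝ) ^ d) (fun k => (calDalev L M a ha k + t • Pmc L M V W k)⁻¹)
      (Cpert (kappaMC d a α β α') (2 * d * Cst d a) (CJ d a) (C2MC d L a α β β') 0 t) ((L : ℝ)⁻¹) :=
  towerLimitRate_perturbed_king L M a ha hL (perturbationLaws_minimalCoupling L M a ha hd hV hW) ht

/-- the same with named limits and the Lipschitz bound in the coupling. [folklore] -/
theorem minimalCoupling_limit (hL : 2 ≤ L) (hd : 1 ≤ d) {V : (k : ℕ) → Fin d → (idx L M k → ℂ)}
    {W : (k : ℕ) → (idx L M k → ℂ)} {α β α' β' : ℝ} (hV : LipschitzBackground L M V α β) (hW : BoundedBackground L M W α' β')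
    {t : ℂ} (ht : ‖t‖ * kappaMC d a α β α' < 1) :
    ∃ ct c0 : Matrix (idx L M 0) (idx L M 0) ℂ,
      Tendsto (pertCov L M a ha (Pmc L M V W) t) atTop (𝓝 ct) ∧ Tendsto (pertCov L M a ha (Pmc L M V W) 0) atTop (𝓝 c0) ∧
      (∀ k, ‖pertCov L M a ha (Pmc L M V W) t k - ct‖
          ≤ Cpert (kappaMC d a α β α') (2 * d * Cst d a) (CJ d a) (C2MC d L a α β β') 0 t * ((L : ℝ)⁻¹) ^ k / (1 - (L : ℝ)⁻¹)) ∧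
      ‖ct - c0‖ ≤ ‖t‖ * kappaMC d a α β α' * Cst d a * (1 - ‖t‖ * kappaMC d a α β α')⁻¹ :=
  ne2Plus_resolvent_route L M a ha hL (perturbationLaws_minimalCoupling L M a ha hd hV hW) ht

end Combined

end Summit.QuantumFields.BalabanUV.T4Continuum.PerturbationAlgebra

end
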